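import Literature.NumberTheory.LFunctions.Zhang2022.DetectorRecipeMoments
import Literature.NumberTheory.LFunctions.Zhang2022.DetectorMainTermFormCS

/-!
# Zhang (2022), programme F-S3 (cell landau-siegel §E, slice S-E-p6-2): a kernel-checkable CERTIFICATE
# FORMAT for `Det.FormDetPSD R` — the one-sided recipe form as the integral of a pointwise Hermitian form,
# and positive semidefiniteness from a polynomial Riccati sub-solution (LQ completion of squares)

Y. Zhang, *Discrete mean estimates and the Landau–Siegel zero*, arXiv:2211.02515v1 [Zhang2022LandauSiegel] —
an unrefereed manuscript under adjudication. **WHAT THIS IS NOT: not a claim about Theorems 1–2 of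
arXiv:2211.02515, about Landau–Siegel zeros, or about Parity; nothing here asserts any claim of the manuscript.
The programme SEARCHES and TYPES; no claim about Landau–Siegel zeros, Theorems 1–2 of arXiv:2211.02515 or a
repaired Margin232 until a kernel theorem says so.**

The slot `Det.FormDetPSD R` («`𝔅_R ≥ 0` on one-sided kinked profiles», registry E-010 second half; displayed in
the §E family `Repair.familyDetShift`, `RepairDetShift`) is a theorem at the printed recipe
(`Det.formDetPSD_zhang`, via the quarter-wave diagonalisation of `MainTermFormPSD`) and, for other recipes, has
NO constant-coefficient sum-of-squares (the bulk symbol of `𝔅_R` is indefinite; positivity on `[0,1]` is a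
compact-support / boundary phenomenon — cell memo barrier/num/SHIFT-PSD.md). This file types the standard
linear-quadratic (second-variation) certificate that DOES exist recipe by recipe, in a kernel-checkable form:

* `formDet_eq_integral_pointwise` — for a one-sided kinked `g` with tail primitive `T(y) = ∫_y^1 g`,
  `𝔅_R(g) = ∫₀¹ ℓ_R(T(y), g(y), g′(y)) dy − 2π Re(m_n·g(0)·conj T(0))`, `ℓ_R` the pointwise Hermitian form
  `pwForm R` read off `Det.formDet_eq_moments` (its only non-local atom `|∫g|² − ⟨g, S_g⟩` equals `∫ g·conj T`);
* (companion `DetectorRecipeCertificateSchur`: `hermForm3_nonneg_of_schur` — a `3 × 3` Hermitian form with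
  positive pivot and PSD Schur complement is `≥ 0` — and `certForm_eq_hermForm3`, putting `certForm` in that shape);
* `formDetPSD_of_certificate` — if `C¹` functions `k₁₁, k₂₂ : ℝ → ℝ`, `k₁₂ : ℝ → ℂ` make the pointwise form
  `ℓ_R + d/dy[k₁₁|T|² + 2Re(k₁₂ T̄g) + k₂₂|g|²]` (`certForm`) non-negative on `[0,1] × ℂ³` and the boundary form
  `k₁₁(0)|a|² + 2Re(k₁₂(0)āb) + k₂₂(0)|b|² − 2πRe(m_n bā)` (`bdForm`) non-negative on `ℂ²`, then `FormDetPSD R`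
  (fundamental theorem of calculus for right derivatives on the kinked class; `T(1) = g(1) = 0`).

The instance `b = (1/2; 2, 5/2)` (polynomial `k`'s found numerically, verified here only through these lemmas)
is `RepairDetShiftPSD`. Elementary calculus; no numerics inside; standard axioms.

References: Y. Zhang, arXiv:2211.02515v1 (2022), Prop. 7.1 with (8.11)–(8.23) [pp. 44–50]; §2 (2.16), Lemma 2.3.
[cite: Zhang2022LandauSiegel, §7 Prop. 7.1, §8 (8.11)–(8.23)]
-/

noncomputable section

open Complex Real ComplexConjugate Set intervalIntegral
open _root_.MeasureTheory

namespace Literature.NumberTheory.LFunctions.Zhang2022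

namespace Det

open Repair

variable {R : DetRecipe} {g g' : ℝ → ℂ}

/-! ### The pointwise forms -/

/-- **The pointwise Hermitian form of formula I** in the atoms `w = T(y) = ∫_y^1 g`, `v = g(y)`, `u = g′(y)`:
`ℓ_R = (2/π)Re(m₀)|u|² + 2Im(m_s u v̄) − 2Im(m_b v ū) + 2πRe(m_n + m_bs)|v|² − 2π²Im(m_bn v w̄)` — the integrand
of `Det.formDet_eq_moments`. [cite: Zhang2022LandauSiegel, Prop 7.1 with (8.11)–(8.23), pp.44–50] -/
def pwForm (R : DetRecipe) (w v u : ℂ) : ℝ :=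
  2 / π * (∑ j : Fin 3, R.W j).re * ‖u‖ ^ 2
    + 2 * ((∑ j : Fin 3, R.W j * (R.s j : ℂ)) * (u * conj v)).im
    - 2 * ((∑ j : Fin 3, R.W j * (R.b j : ℂ)) * (v * conj u)).im
    + 2 * π * ((∑ j : Fin 3, R.W j * (R.n j : ℂ)) + ∑ j : Fin 3, R.W j * ((R.b j : ℂ) * (R.s j : ℂ))).re
        * ‖v‖ ^ 2
    - 2 * π ^ 2 * ((∑ j : Fin 3, R.W j * ((R.b j : ℂ) * (R.n j : ℂ))) * (v * conj w)).im

/-- **The certificate form**: `ℓ_R(w,v,u)` plus the `y`-derivative of `k₁₁|T|² + 2Re(k₁₂T̄g) + k₂₂|g|²` along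
`T′ = −g`, `g′ = u`, written in the VALUES `(k₁₁, k₁₁′, k₂₂, k₂₂′, k₁₂, k₁₂′)` at the point.
[cite: Zhang2022LandauSiegel, Prop 7.1 with (8.11)–(8.23), pp.44–50] -/
def certForm (R : DetRecipe) (k11 k11' k22 k22' : ℝ) (k12 k12' : ℂ) (w v u : ℂ) : ℝ :=
  pwForm R w v u
    + (k11' * ‖w‖ ^ 2 + 2 * (k12' * (conj w * v)).re - 2 * k11 * (conj w * v).re + k22' * ‖v‖ ^ 2
        - 2 * k12.re * ‖v‖ ^ 2 + 2 * (k12 * (conj w * u)).re + 2 * k22 * (conj v * u).re)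

/-- **The boundary form** at `y = 0` in `(a, b) = (T(0), g(0)) = (∫₀¹ g, g(0))`:
`k₁₁(0)|a|² + 2Re(k₁₂(0)āb) + k₂₂(0)|b|² − 2πRe(m_n b ā)`. [cite: Zhang2022LandauSiegel, Prop 7.1 with (8.11)–(8.23), pp.44–50] -/
def bdForm (R : DetRecipe) (h11 h22 : ℝ) (h12 : ℂ) (a b : ℂ) : ℝ :=
  h11 * ‖a‖ ^ 2 + 2 * (h12 * (conj a * b)).re + h22 * ‖b‖ ^ 2
    - 2 * π * ((∑ j : Fin 3, R.W j * (R.n j : ℂ)) * (b * conj a)).re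

/-! ### Calculus of the tail primitive on the kinked class -/

/-- The tail primitive `y ↦ ∫_y^1 g` has derivative `−g(x)` at interior points (`g` continuous on `[0,1]`).
[cite: Zhang2022LandauSiegel, Prop 7.1, Lemma 8.4] -/
theorem hasDerivAt_tail_unit (hg : ContinuousOn g (Icc 0 1)) {x : ℝ} (hx : x ∈ Ioo (0:ℝ) 1) :
    HasDerivAt (fun y => ∫ t in y..(1:ℝ), g t) (-g x) x := by
  have hint : IntervalIntegrable g volume x 1 :=
    (hg.mono (Icc_subset_Icc hx.1.le le_rfl)).intervalIntegrable_of_Icc hx.2.le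
  have hmeas : StronglyMeasurableAtFilter g (nhds x) volume :=
    ContinuousOn.stronglyMeasurableAtFilter isOpen_Ioo (hg.mono Ioo_subset_Icc_self) x hx
  have hcont : ContinuousAt g x := hg.continuousAt (Icc_mem_nhds hx.1 hx.2)
  exact intervalIntegral.integral_hasDerivAt_left hint hmeas hcont

/-- Real part of an integrable function is interval-integrable. [folklore] -/
private theorem intervalIntegrable_re_comp {F : ℝ → ℂ} {a b : ℝ} (h : IntervalIntegrable F volume a b) :
    IntervalIntegrable (fun x => (F x).re) volume a b :=
  ⟨h.1.re, h.2.re⟩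

/-- `∫ (c·F).im = (c·∫F).im` on `[0,1]`. [folklore] -/
private theorem integral_im_const_mul {F : ℝ → ℂ} (h : IntervalIntegrable F volume 0 1) (c : ℂ) :
    ∫ x in (0:ℝ)..1, (c * F x).im = (c * ∫ x in (0:ℝ)..1, F x).im := by
  rw [← intervalIntegral.integral_const_mul]
  have := intervalIntegral.intervalIntegral_im (h.const_mul c)
  simpa using this

/-- The non-local atom of `formDet_eq_moments` is the local pairing with the tail:
`|∫g|² − ∫ g·conj(∫₀ˣ g) = ∫ g·conj(∫ₓ¹ g)`. [cite: Zhang2022LandauSiegel, Prop 7.1 with (8.11)–(8.23), pp.44–50] -/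
theorem atom7_eq_tail (hg : ContinuousOn g (Icc 0 1)) :
    (∫ x in (0:ℝ)..1, g x) * conj (∫ x in (0:ℝ)..1, g x)
        - (∫ x in (0:ℝ)..1, g x * conj (∫ t in (0:ℝ)..x, g t))
      = ∫ x in (0:ℝ)..1, g x * conj (∫ t in x..(1:ℝ), g t) := by
  set I0 : ℂ := ∫ x in (0:ℝ)..1, g x with hI0
  have hgi : IntervalIntegrable g volume 0 1 := hg.intervalIntegrable_of_Icc zero_le_one
  have hsplit : ∀ x ∈ uIcc (0:ℝ) 1,
      g x * conj (∫ t in (0:ℝ)..x, g t) = g x * conj I0 - g x * conj (∫ t in x..(1:ℝ), g t) := by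
    intro x hx
    rw [uIcc_of_le zero_le_one] at hx
    have h1 : IntervalIntegrable g volume 0 x :=
      hgi.mono_set (by rw [uIcc_of_le zero_le_one, uIcc_of_le hx.1]; exact Icc_subset_Icc_right hx.2)
    have h2 : IntervalIntegrable g volume x 1 :=
      hgi.mono_set (by rw [uIcc_of_le zero_le_one, uIcc_of_le hx.2]; exact Icc_subset_Icc_left hx.1)
    have := intervalIntegral.integral_add_adjacent_intervals h1 h2
    rw [hI0, ← this, map_add]
    ring
  have i1 : IntervalIntegrable (fun x => g x * conj I0) volume 0 1 := hgi.mul_const _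
  have i2 : IntervalIntegrable (fun x => g x * conj (∫ t in x..(1:ℝ), g t)) volume 0 1 :=
    (hg.mul (continuousOn_conj_comp (continuousOn_tail_unit hg))).intervalIntegrable_of_Icc zero_le_one
  rw [intervalIntegral.integral_congr hsplit, intervalIntegral.integral_sub i1 i2,
    intervalIntegral.integral_mul_const]
  ring

/-- The pointwise form is integrable along `(T, g, g′)` for a kinked profile. [folklore] -/
private theorem intervalIntegrable_pwForm (hg : KinkedProfile g g') :
    IntervalIntegrable (fun y => pwForm R (∫ t in y..(1:ℝ), g t) (g y) (g' y)) volume 0 1 := by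
  have hH := hg.isH1
  have i1 : IntervalIntegrable (fun y => ‖g' y‖ ^ 2) volume 0 1 := hH.intervalIntegrable_sq
  have i2 : IntervalIntegrable (fun y => g' y * conj (g y)) volume 0 1 :=
    IsH1OnUnitInterval.intervalIntegrable_deriv_mul_conj hH hH
  have i4 : IntervalIntegrable (fun y => g y * conj (g' y)) volume 0 1 := by
    have hch' : IntervalIntegrable (fun x => conj (g' x)) volume 0 1 := by
      rw [intervalIntegrable_iff, uIoc_of_le zero_le_one]
      exact hH.memLp_conj.integrable one_le_two
    exact hch'.continuousOn_mul (by rw [uIcc_of_le zero_le_one]; exact hg.cont)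
  have i5 : IntervalIntegrable (fun y => ‖g y‖ ^ 2) volume 0 1 :=
    ((hg.cont.norm).pow 2).intervalIntegrable_of_Icc zero_le_one
  have i7 : IntervalIntegrable (fun y => g y * conj (∫ t in y..(1:ℝ), g t)) volume 0 1 :=
    (hg.cont.mul (continuousOn_conj_comp (continuousOn_tail_unit hg.cont))).intervalIntegrable_of_Icc
      zero_le_one
  have j2 : IntervalIntegrable (fun y => ((∑ j : Fin 3, R.W j * (R.s j : ℂ)) * (g' y * conj (g y))).im)
      volume 0 1 :=
    (intervalIntegrable_re_comp ((i2.const_mul (∑ j : Fin 3, R.W j * (R.s j : ℂ))).const_mul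
      (-I))).congr_uIoo fun y _ => by simp [Complex.mul_re, Complex.mul_im]
  have j3 : IntervalIntegrable (fun y => ((∑ j : Fin 3, R.W j * (R.b j : ℂ)) * (g y * conj (g' y))).im)
      volume 0 1 :=
    (intervalIntegrable_re_comp ((i4.const_mul (∑ j : Fin 3, R.W j * (R.b j : ℂ))).const_mul
      (-I))).congr_uIoo fun y _ => by simp [Complex.mul_re, Complex.mul_im]
  have j5 : IntervalIntegrable (fun y => ((∑ j : Fin 3, R.W j * ((R.b j : ℂ) * (R.n j : ℂ)))
      * (g y * conj (∫ t in y..(1:ℝ), g t))).im) volume 0 1 :=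
    (intervalIntegrable_re_comp ((i7.const_mul (∑ j : Fin 3, R.W j * ((R.b j : ℂ) * (R.n j : ℂ)))).const_mul
      (-I))).congr_uIoo fun y _ => by simp [Complex.mul_re, Complex.mul_im]
  exact ((((i1.const_mul _).add (j2.const_mul 2)).sub (j3.const_mul 2)).add (i5.const_mul _)).sub
    (j5.const_mul _)

/-- **`𝔅_R` as the integral of its pointwise form plus the boundary term at `y = 0`** (one-sided kinked `g`):
`𝔅_R(g) = ∫₀¹ ℓ_R(T, g, g′) − 2πRe(m_n g(0) conj T(0))`, `T(y) = ∫_y^1 g`.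
[cite: Zhang2022LandauSiegel, Prop 7.1 with (8.11)–(8.23), pp.44–50] -/
theorem formDet_eq_integral_pointwise (hg : KinkedProfile g g') (hg1 : g 1 = 0) :
    FormDet R g g'
      = (∫ y in (0:ℝ)..1, pwForm R (∫ t in y..(1:ℝ), g t) (g y) (g' y))
        - 2 * π * ((∑ j : Fin 3, R.W j * (R.n j : ℂ))
            * (g 0 * conj (∫ t in (0:ℝ)..1, g t))).re := by
  have hH := hg.isH1
  -- integrability of the five atoms
  have i1 : IntervalIntegrable (fun y => ‖g' y‖ ^ 2) volume 0 1 := hH.intervalIntegrable_sq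
  have i2 : IntervalIntegrable (fun y => g' y * conj (g y)) volume 0 1 :=
    IsH1OnUnitInterval.intervalIntegrable_deriv_mul_conj hH hH
  have i4 : IntervalIntegrable (fun y => g y * conj (g' y)) volume 0 1 := by
    have hch' : IntervalIntegrable (fun x => conj (g' x)) volume 0 1 := by
      rw [intervalIntegrable_iff, uIoc_of_le zero_le_one]
      exact hH.memLp_conj.integrable one_le_two
    exact hch'.continuousOn_mul (by rw [uIcc_of_le zero_le_one]; exact hg.cont)
  have i5 : IntervalIntegrable (fun y => ‖g y‖ ^ 2) volume 0 1 :=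
    ((hg.cont.norm).pow 2).intervalIntegrable_of_Icc zero_le_one
  have i7 : IntervalIntegrable (fun y => g y * conj (∫ t in y..(1:ℝ), g t)) volume 0 1 :=
    (hg.cont.mul (continuousOn_conj_comp (continuousOn_tail_unit hg.cont))).intervalIntegrable_of_Icc
      zero_le_one
  -- abbreviations for the moments
  set m0 : ℂ := ∑ j : Fin 3, R.W j with hm0
  set ms : ℂ := ∑ j : Fin 3, R.W j * (R.s j : ℂ) with hms
  set mn : ℂ := ∑ j : Fin 3, R.W j * (R.n j : ℂ) with hmn
  set mb : ℂ := ∑ j : Fin 3, R.W j * (R.b j : ℂ) with hmb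
  set mbs : ℂ := ∑ j : Fin 3, R.W j * ((R.b j : ℂ) * (R.s j : ℂ)) with hmbs
  set mbn : ℂ := ∑ j : Fin 3, R.W j * ((R.b j : ℂ) * (R.n j : ℂ)) with hmbn
  -- the integral of the pointwise form, term by term
  have e1 : (∫ y in (0:ℝ)..1, 2 / π * m0.re * ‖g' y‖ ^ 2) = 2 / π * m0.re * ∫ y in (0:ℝ)..1, ‖g' y‖ ^ 2 :=
    intervalIntegral.integral_const_mul _ _
  have e2 : (∫ y in (0:ℝ)..1, 2 * (ms * (g' y * conj (g y))).im)
      = 2 * (ms * ∫ y in (0:ℝ)..1, g' y * conj (g y)).im := by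
    rw [intervalIntegral.integral_const_mul, integral_im_const_mul i2]
  have e3 : (∫ y in (0:ℝ)..1, 2 * (mb * (g y * conj (g' y))).im)
      = 2 * (mb * ∫ y in (0:ℝ)..1, g y * conj (g' y)).im := by
    rw [intervalIntegral.integral_const_mul, integral_im_const_mul i4]
  have e4 : (∫ y in (0:ℝ)..1, 2 * π * (mn + mbs).re * ‖g y‖ ^ 2)
      = 2 * π * (mn + mbs).re * ∫ y in (0:ℝ)..1, ‖g y‖ ^ 2 :=
    intervalIntegral.integral_const_mul _ _
  have e5 : (∫ y in (0:ℝ)..1, 2 * π ^ 2 * (mbn * (g y * conj (∫ t in y..(1:ℝ), g t))).im)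
      = 2 * π ^ 2 * (mbn * ∫ y in (0:ℝ)..1, g y * conj (∫ t in y..(1:ℝ), g t)).im := by
    rw [intervalIntegral.integral_const_mul, integral_im_const_mul i7]
  -- integrability of the five terms
  have j1 : IntervalIntegrable (fun y => 2 / π * m0.re * ‖g' y‖ ^ 2) volume 0 1 := i1.const_mul _
  have j2 : IntervalIntegrable (fun y => 2 * (ms * (g' y * conj (g y))).im) volume 0 1 :=
    ((intervalIntegrable_re_comp ((i2.const_mul ms).const_mul (-I))).const_mul 2).congr_uIoo
      fun y _ => by simp [Complex.mul_im, Complex.mul_re]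
  have j3 : IntervalIntegrable (fun y => 2 * (mb * (g y * conj (g' y))).im) volume 0 1 :=
    ((intervalIntegrable_re_comp ((i4.const_mul mb).const_mul (-I))).const_mul 2).congr_uIoo
      fun y _ => by simp [Complex.mul_im, Complex.mul_re]
  have j4 : IntervalIntegrable (fun y => 2 * π * (mn + mbs).re * ‖g y‖ ^ 2) volume 0 1 := i5.const_mul _
  have j5 : IntervalIntegrable
      (fun y => 2 * π ^ 2 * (mbn * (g y * conj (∫ t in y..(1:ℝ), g t))).im) volume 0 1 :=
    ((intervalIntegrable_re_comp ((i7.const_mul mbn).const_mul (-I))).const_mul (2 * π ^ 2)).congr_uIoo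
      fun y _ => by simp [Complex.mul_im, Complex.mul_re]
  have key : (∫ y in (0:ℝ)..1, pwForm R (∫ t in y..(1:ℝ), g t) (g y) (g' y))
      = 2 / π * m0.re * (∫ y in (0:ℝ)..1, ‖g' y‖ ^ 2)
        + 2 * (ms * ∫ y in (0:ℝ)..1, g' y * conj (g y)).im
        - 2 * (mb * ∫ y in (0:ℝ)..1, g y * conj (g' y)).im
        + 2 * π * (mn + mbs).re * (∫ y in (0:ℝ)..1, ‖g y‖ ^ 2)
        - 2 * π ^ 2 * (mbn * ∫ y in (0:ℝ)..1, g y * conj (∫ t in y..(1:ℝ), g t)).im := by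
    have hpw : ∀ y, pwForm R (∫ t in y..(1:ℝ), g t) (g y) (g' y)
        = 2 / π * m0.re * ‖g' y‖ ^ 2 + 2 * (ms * (g' y * conj (g y))).im
          - 2 * (mb * (g y * conj (g' y))).im + 2 * π * (mn + mbs).re * ‖g y‖ ^ 2
          - 2 * π ^ 2 * (mbn * (g y * conj (∫ t in y..(1:ℝ), g t))).im := fun y => rfl
    simp_rw [hpw]
    rw [intervalIntegral.integral_sub (((j1.add j2).sub j3).add j4) j5,
      intervalIntegral.integral_add ((j1.add j2).sub j3) j4,
      intervalIntegral.integral_sub (j1.add j2) j3, intervalIntegral.integral_add j1 j2,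
      e1, e2, e3, e4, e5]
  rw [key, formDet_eq_moments hg hg1, atom7_eq_tail hg.cont]
  simp only [← hm0, ← hms, ← hmn, ← hmb, ← hmbs, ← hmbn]
  ring

/-! ### The certificate theorem -/

/-- `(conj ∘ h)` inherits a right derivative. [folklore] -/
private theorem hasDerivWithinAt_conj_comp {h : ℝ → ℂ} {h' : ℂ} {s : Set ℝ} {x : ℝ}
    (hh : HasDerivWithinAt h h' s x) : HasDerivWithinAt (fun x => conj (h x)) (conj h') s x := by
  simpa using hh.star

/-- **`FormDetPSD R` from an LQ certificate.** Let `k₁₁, k₂₂ : ℝ → ℝ` and `k₁₂ : ℝ → ℂ` be differentiable with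
continuous derivatives `k₁₁′, k₂₂′, k₁₂′`. If (pointwise) `certForm R (k(y), k′(y)) (w, v, u) ≥ 0` for all
`y ∈ [0,1]` and all `w, v, u ∈ ℂ`, and (boundary) `bdForm R (k₁₁(0), k₂₂(0), k₁₂(0)) (a, b) ≥ 0` for all
`a, b ∈ ℂ`, then `𝔅_R(g) ≥ 0` for every one-sided kinked profile: indeed
`𝔅_R(g) = ∫₀¹ certForm(…)(T, g, g′) dy + bdForm(…)(T(0), g(0))` by `formDet_eq_integral_pointwise` and the
fundamental theorem of calculus for `Φ = k₁₁|T|² + 2Re(k₁₂T̄g) + k₂₂|g|²` (`Φ(1) = 0`).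
[cite: Zhang2022LandauSiegel, Prop 7.1 with (8.11)–(8.23), pp.44–50; §2 (2.16)] -/
theorem formDetPSD_of_certificate (k11 k22 k11' k22' : ℝ → ℝ) (k12 k12' : ℝ → ℂ)
    (hk11 : ∀ y, HasDerivAt k11 (k11' y) y) (hk22 : ∀ y, HasDerivAt k22 (k22' y) y)
    (hk12 : ∀ y, HasDerivAt k12 (k12' y) y)
    (hc11 : Continuous k11') (hc22 : Continuous k22') (hc12 : Continuous k12')
    (HP : ∀ y ∈ Icc (0:ℝ) 1, ∀ w v u : ℂ,
      0 ≤ certForm R (k11 y) (k11' y) (k22 y) (k22' y) (k12 y) (k12' y) w v u)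
    (HB : ∀ a b : ℂ, 0 ≤ bdForm R (k11 0) (k22 0) (k12 0) a b) :
    FormDetPSD R := by
  intro g g' hg hg1
  -- continuity of the `k`'s
  have ck11 : Continuous k11 := continuous_iff_continuousAt.2 fun y => (hk11 y).continuousAt
  have ck22 : Continuous k22 := continuous_iff_continuousAt.2 fun y => (hk22 y).continuousAt
  have ck12 : Continuous k12 := continuous_iff_continuousAt.2 fun y => (hk12 y).continuousAt
  -- the tail primitive and its calculus
  set T : ℝ → ℂ := fun y => ∫ t in y..(1:ℝ), g t with hT
  have hTc : ContinuousOn T (Icc 0 1) := continuousOn_tail_unit hg.cont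
  have hT1 : T 1 = 0 := by simp [hT]
  have hTd : ∀ x ∈ Ioo (0:ℝ) 1, HasDerivAt T (-g x) x := fun x hx => hasDerivAt_tail_unit hg.cont hx
  -- the potential Φ (complex-valued, real in value) and its right derivative
  set Φ : ℝ → ℂ := fun y => (k11 y : ℂ) * (T y * conj (T y))
      + (k12 y * (conj (T y) * g y) + conj (k12 y * (conj (T y) * g y)))
      + (k22 y : ℂ) * (g y * conj (g y)) with hΦ
  set dΦ : ℝ → ℂ := fun y => ((k11' y : ℂ) * (T y * conj (T y)) + (k11 y : ℂ) * (-g y * conj (T y) + T y * conj (-g y)))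
      + ((k12' y * (conj (T y) * g y) + k12 y * (conj (-g y) * g y + conj (T y) * g' y))
          + conj (k12' y * (conj (T y) * g y) + k12 y * (conj (-g y) * g y + conj (T y) * g' y)))
      + ((k22' y : ℂ) * (g y * conj (g y)) + (k22 y : ℂ) * (g' y * conj (g y) + g y * conj (g' y))) with hdΦ
  have hΦ1 : Φ 1 = 0 := by simp [hΦ, hT1, hg1]
  have hΦc : ContinuousOn Φ (Icc 0 1) := by
    have hgc := hg.cont
    have hTcc := continuousOn_conj_comp hTc
    have hgcc := continuousOn_conj_comp hgc
    refine ((((Complex.continuous_ofReal.comp ck11).continuousOn).mul (hTc.mul hTcc)).add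
      (((ck12.continuousOn.mul (hTcc.mul hgc))).add
        (continuousOn_conj_comp (ck12.continuousOn.mul (hTcc.mul hgc))))).add
      (((Complex.continuous_ofReal.comp ck22).continuousOn).mul (hgc.mul hgcc))
  have hΦd : ∀ x ∈ Ioo (0:ℝ) 1, HasDerivWithinAt Φ (dΦ x) (Ioi x) x := by
    intro x hx
    have dT : HasDerivWithinAt T (-g x) (Ioi x) x := (hTd x hx).hasDerivWithinAt
    have dTc : HasDerivWithinAt (fun y => conj (T y)) (conj (-g x)) (Ioi x) x := hasDerivWithinAt_conj_comp dT
    have dg : HasDerivWithinAt g (g' x) (Ioi x) x := hg.hasDeriv x hx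
    have dgc : HasDerivWithinAt (fun y => conj (g y)) (conj (g' x)) (Ioi x) x := hasDerivWithinAt_conj_comp dg
    have d11 : HasDerivWithinAt (fun y => (k11 y : ℂ)) (k11' x) (Ioi x) x :=
      (hk11 x).ofReal_comp.hasDerivWithinAt
    have d22 : HasDerivWithinAt (fun y => (k22 y : ℂ)) (k22' x) (Ioi x) x :=
      (hk22 x).ofReal_comp.hasDerivWithinAt
    have d12 : HasDerivWithinAt k12 (k12' x) (Ioi x) x := (hk12 x).hasDerivWithinAt
    have t1 := d11.mul (dT.mul dTc)
    have t2a := d12.mul (dTc.mul dg)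
    have t2 := t2a.add (hasDerivWithinAt_conj_comp t2a)
    have t3 := d22.mul (dg.mul dgc)
    exact (t1.add t2).add t3
  -- integrability of dΦ
  have hdΦi : IntervalIntegrable dΦ volume 0 1 := by
    have hgc := hg.cont
    have hTcc := continuousOn_conj_comp hTc
    have hgcc := continuousOn_conj_comp hgc
    have hg'i : IntervalIntegrable g' volume 0 1 := hg.isH1.intervalIntegrable
    have hg'ci : IntervalIntegrable (fun x => conj (g' x)) volume 0 1 := by
      rw [intervalIntegrable_iff, uIoc_of_le zero_le_one]
      exact hg.isH1.memLp_conj.integrable one_le_two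
    have hI : uIcc (0:ℝ) 1 = Icc 0 1 := uIcc_of_le zero_le_one
    -- continuous pieces
    have c1 : ContinuousOn (fun y => (k11' y : ℂ) * (T y * conj (T y))
        + (k11 y : ℂ) * (-g y * conj (T y) + T y * conj (-g y))) (Icc 0 1) :=
      (((Complex.continuous_ofReal.comp hc11).continuousOn).mul (hTc.mul hTcc)).add
        (((Complex.continuous_ofReal.comp ck11).continuousOn).mul
          ((hgc.neg.mul hTcc).add (hTc.mul (continuousOn_conj_comp hgc.neg))))
    have c2 : ContinuousOn (fun y => k12' y * (conj (T y) * g y) + k12 y * (conj (-g y) * g y)) (Icc 0 1) :=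
      (hc12.continuousOn.mul (hTcc.mul hgc)).add (ck12.continuousOn.mul ((continuousOn_conj_comp hgc.neg).mul hgc))
    have c3 : ContinuousOn (fun y => k12 y * conj (T y)) (Icc 0 1) := ck12.continuousOn.mul hTcc
    have c4 : ContinuousOn (fun y => (k22' y : ℂ) * (g y * conj (g y))) (Icc 0 1) :=
      ((Complex.continuous_ofReal.comp hc22).continuousOn).mul (hgc.mul hgcc)
    have c5 : ContinuousOn (fun y => (k22 y : ℂ) * conj (g y)) (Icc 0 1) :=
      ((Complex.continuous_ofReal.comp ck22).continuousOn).mul hgcc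
    have c6 : ContinuousOn (fun y => (k22 y : ℂ) * g y) (Icc 0 1) :=
      ((Complex.continuous_ofReal.comp ck22).continuousOn).mul hgc
    -- pieces with g'
    have p1 : IntervalIntegrable (fun y => k12' y * (conj (T y) * g y) + k12 y * (conj (-g y) * g y)
        + k12 y * conj (T y) * g' y) volume 0 1 :=
      (c2.intervalIntegrable_of_Icc zero_le_one).add (hg'i.continuousOn_mul (by rwa [hI]))
    have p1c : IntervalIntegrable (fun y => conj (k12' y * (conj (T y) * g y) + k12 y * (conj (-g y) * g y)
        + k12 y * conj (T y) * g' y)) volume 0 1 := by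
      rw [intervalIntegrable_iff] at p1 ⊢
      exact (Complex.conjCLE.toContinuousLinearMap).integrable_comp p1
    have p3 : IntervalIntegrable (fun y => (k22' y : ℂ) * (g y * conj (g y))
        + ((k22 y : ℂ) * conj (g y) * g' y + (k22 y : ℂ) * g y * conj (g' y))) volume 0 1 :=
      (c4.intervalIntegrable_of_Icc zero_le_one).add
        ((hg'i.continuousOn_mul (by rwa [hI])).add (hg'ci.continuousOn_mul (by rwa [hI])))
    have := ((c1.intervalIntegrable_of_Icc zero_le_one).add (p1.add p1c)).add p3
    refine this.congr_uIoo fun y _ => ?_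
    simp only [hdΦ, map_add, map_mul]
    ring
  -- FTC: ∫ dΦ = Φ 1 − Φ 0 = −Φ 0
  have ftc : ∫ y in (0:ℝ)..1, dΦ y = Φ 1 - Φ 0 :=
    intervalIntegral.integral_eq_sub_of_hasDeriv_right_of_le zero_le_one hΦc hΦd hdΦi
  -- real parts: (dΦ y).re is the `k`-part of certForm, (Φ 0).re is the `k`-part of bdForm
  have hre : ∀ y, (dΦ y).re
      = certForm R (k11 y) (k11' y) (k22 y) (k22' y) (k12 y) (k12' y) (T y) (g y) (g' y)
          - pwForm R (T y) (g y) (g' y) := by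
    intro y
    simp only [hdΦ, certForm, Complex.sq_norm, Complex.normSq_apply, Complex.add_re, Complex.add_im,
      Complex.mul_re, Complex.mul_im, Complex.conj_re, Complex.conj_im,
      Complex.ofReal_re, Complex.ofReal_im, Complex.neg_re, Complex.neg_im, map_add, map_mul,
      Complex.conj_conj]
    ring
  have hre0 : (Φ 0).re = bdForm R (k11 0) (k22 0) (k12 0) (T 0) (g 0)
      + 2 * π * ((∑ j : Fin 3, R.W j * (R.n j : ℂ)) * (g 0 * conj (T 0))).re := by
    simp only [hΦ, bdForm, Complex.sq_norm, Complex.normSq_apply, Complex.add_re,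
      Complex.mul_re, Complex.mul_im, Complex.conj_re, Complex.conj_im,
      Complex.ofReal_re, Complex.ofReal_im, map_mul, Complex.conj_conj]
    ring
  -- integral of the real part
  have hint_re : ∫ y in (0:ℝ)..1, (dΦ y).re = -(Φ 0).re := by
    have := intervalIntegral.intervalIntegral_re hdΦi
    simp only [RCLike.re_to_complex] at this
    rw [this, ftc, hΦ1, zero_sub, Complex.neg_re]
  -- the pointwise form is integrable (difference of two integrable real functions)
  have hcert_nonneg : 0 ≤ ∫ y in (0:ℝ)..1,
      certForm R (k11 y) (k11' y) (k22 y) (k22' y) (k12 y) (k12' y) (T y) (g y) (g' y) :=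
    intervalIntegral.integral_nonneg zero_le_one fun y hy => HP y hy _ _ _
  have hsplit : (∫ y in (0:ℝ)..1, pwForm R (T y) (g y) (g' y))
      = (∫ y in (0:ℝ)..1, certForm R (k11 y) (k11' y) (k22 y) (k22' y) (k12 y) (k12' y) (T y) (g y) (g' y))
        - ∫ y in (0:ℝ)..1, (dΦ y).re := by
    have hdre : IntervalIntegrable (fun y => (dΦ y).re) volume 0 1 := intervalIntegrable_re_comp hdΦi
    have hpw_eq : (fun y => pwForm R (T y) (g y) (g' y))
        = fun y => certForm R (k11 y) (k11' y) (k22 y) (k22' y) (k12 y) (k12' y) (T y) (g y) (g' y)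
            - (dΦ y).re := by
      funext y; rw [hre y]; ring
    -- integrability of certForm∘(T,g,g') = pwForm + (dΦ).re, where pwForm∘… is integrable:
    have hpwi : IntervalIntegrable (fun y => pwForm R (T y) (g y) (g' y)) volume 0 1 :=
      intervalIntegrable_pwForm hg
    have hci : IntervalIntegrable
        (fun y => certForm R (k11 y) (k11' y) (k22 y) (k22' y) (k12 y) (k12' y) (T y) (g y) (g' y))
        volume 0 1 := by
      have := hpwi.add hdre
      refine this.congr_uIoo fun y _ => ?_
      show pwForm R (T y) (g y) (g' y) + (dΦ y).re = _
      rw [hre y]; ring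
    rw [hpw_eq, intervalIntegral.integral_sub hci hdre]
  -- assemble
  rw [formDet_eq_integral_pointwise hg hg1, hsplit, hint_re, hre0]
  have hb := HB (T 0) (g 0)
  linarith

end Det

end Literature.NumberTheory.LFunctions.Zhang2022
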